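import Mathlib
import HarnessLib

/-!
# Item `LrcModEntire` (stmt-NavierStokesRegularity-20428), CLASS road to `stub_twistingTHGerm` — the SIMILARITY MAP for the plane-oscillation law:
# `(t,z) ↦ (τ,ξ) = (−log(−t), z/√(−t))`, `Q = √(−t)·O`, `Ŝ = √(−t)·S` turns (OSC) `∂ₜO + ½∂_z(S·O) − ∂_zzO ≤ 0` into `∂_τQ + ½∂_ξ((ξ+Ŝ)Q) ≤ ∂_ξξQ`

Cell ns-regularity-ideate, LEAD ns-poloidal-K2-p3 g13 (`--supports stmt-NavierStokesRegularity-20428`).  The bookkeeping link between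
`…TwistingTHPlaneOscillationEnvelope.osc_divergence_form` ((t,z)-currency, port-2) and `…TwistingTHOscLiouville.eq_zero_of_ancient_oscSubsolution_anyK`
((τ,ξ)-currency, this seat ∘ port-2): with `s := e^{−τ/2} = √(−t)`, `t = −s²`, `z = ξs`,
`Q(τ,ξ) := s·O(t,z)`, `Ŝ(τ,ξ) := s·S(t,z)`, one has pointwise
* `hasDerivAt_simQ_time` — `∂_τQ = −(s/2)O + s³∂ₜO − (ξs²/2)∂_zO` (needs joint differentiability of `O` at `(t,z)`);
* `deriv_simQ`, `deriv_deriv_simQ`, `deriv_transport_sim` — `∂_ξQ = s²∂_zO`, `∂_ξξQ = s³∂_zzO`, `∂_ξ((ξ+Ŝ)Q) = sO + ξs²∂_zO + s³∂_z(SO)`;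
* `sim_identity` — `∂_τQ + ½∂_ξ((ξ+Ŝ)Q) − ∂_ξξQ = s³·(∂ₜO + ½∂_z(SO) − ∂_zzO)`;
* `sim_subsolution` — hence (OSC) at `(t,z)` ⇒ the similarity inequality at `(τ,ξ)` (as `s³ > 0`), in the `hsub` shape of `_anyK`.
No definitions (explicit lambdas), no Navier–Stokes input: chain rule only.

WHAT THIS IS NOT: not a claim about Navier–Stokes regularity and not the stub (bears_on LADDER-NS N0, item 20428 / crux 19708; both OPEN).
-/

noncomputable section

-- the summit and its single sub-problem share the name (CONVENTIONS §1), as in every Theorems file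
set_option linter.dupNamespace false

namespace Summit.NavierStokesRegularity.NavierStokesRegularity.Theorems.PoloidalWindowDoorLrcModEntireTwistingTHPlaneOscillationSimilarityMap

open Set Filter Topology

variable {O S : ℝ → ℝ → ℝ}

/-! ### The curve `τ ↦ (t, z) = (−e^{−τ}, ξ e^{−τ/2})` -/

/-- `d/dτ (−e^{−τ}) = e^{−τ}`. -/
theorem hasDerivAt_time_of_tau (τ : ℝ) : HasDerivAt (fun τ' : ℝ => -Real.exp (-τ')) (Real.exp (-τ)) τ := by
  have h := ((hasDerivAt_id τ).fun_neg.exp).fun_neg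
  refine h.congr_deriv ?_
  simp

/-- `d/dτ e^{−τ/2} = −½ e^{−τ/2}`. -/
theorem hasDerivAt_scale_of_tau (τ : ℝ) :
    HasDerivAt (fun τ' : ℝ => Real.exp (-τ' / 2)) (-(1 / 2) * Real.exp (-τ / 2)) τ := by
  have h1 : HasDerivAt (fun τ' : ℝ => -τ' / 2) (-(1 / 2)) τ := by
    refine (((hasDerivAt_id τ).fun_neg).div_const 2).congr_deriv ?_
    norm_num
  refine h1.exp.congr_deriv ?_
  ring

/-- `d/dτ (ξ e^{−τ/2}) = −(ξ/2) e^{−τ/2}`. -/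
theorem hasDerivAt_height_of_tau (ξ τ : ℝ) :
    HasDerivAt (fun τ' : ℝ => ξ * Real.exp (-τ' / 2)) (-(ξ / 2) * Real.exp (-τ / 2)) τ := by
  refine ((hasDerivAt_scale_of_tau τ).const_mul ξ).congr_deriv ?_
  ring

/-! ### The time derivative of `Q` -/

/-- **`∂_τQ`**.  If `uncurry O` is (Fréchet) differentiable at `(t,z) = (−e^{−τ}, ξe^{−τ/2})` with derivative `L`, then
`τ' ↦ Q(τ',ξ) = e^{−τ'/2}·O(−e^{−τ'}, ξe^{−τ'/2})` has derivative `−½s·O(t,z) + s·(s²·L(1,0) − (ξs/2)·L(0,1))` at `τ` (`s = e^{−τ/2}`). -/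
theorem hasDerivAt_simQ_time {τ ξ : ℝ} {L : ℝ × ℝ →L[ℝ] ℝ}
    (hO : HasFDerivAt (Function.uncurry O) L (-Real.exp (-τ), ξ * Real.exp (-τ / 2))) :
    HasDerivAt (fun τ' : ℝ => Real.exp (-τ' / 2) * O (-Real.exp (-τ')) (ξ * Real.exp (-τ' / 2)))
      (-(1 / 2) * Real.exp (-τ / 2) * O (-Real.exp (-τ)) (ξ * Real.exp (-τ / 2)) +
        Real.exp (-τ / 2) * (Real.exp (-τ) * L (1, 0) + (-(ξ / 2) * Real.exp (-τ / 2)) * L (0, 1))) τ := by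
  -- the curve and its derivative
  have hφ : HasDerivAt (fun τ' : ℝ => ((-Real.exp (-τ'), ξ * Real.exp (-τ' / 2)) : ℝ × ℝ))
      ((Real.exp (-τ), -(ξ / 2) * Real.exp (-τ / 2)) : ℝ × ℝ) τ :=
    (hasDerivAt_time_of_tau τ).prodMk (hasDerivAt_height_of_tau ξ τ)
  have hcomp := hO.comp_hasDerivAt τ hφ
  have hL : L ((Real.exp (-τ), -(ξ / 2) * Real.exp (-τ / 2)) : ℝ × ℝ) =
      Real.exp (-τ) * L (1, 0) + (-(ξ / 2) * Real.exp (-τ / 2)) * L (0, 1) := by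
    have e : ((Real.exp (-τ), -(ξ / 2) * Real.exp (-τ / 2)) : ℝ × ℝ) =
        (Real.exp (-τ)) • ((1, 0) : ℝ × ℝ) + (-(ξ / 2) * Real.exp (-τ / 2)) • ((0, 1) : ℝ × ℝ) := by
      ext <;> simp
    rw [e, map_add, map_smul, map_smul, smul_eq_mul, smul_eq_mul]
  have hcomp' : HasDerivAt (fun τ' : ℝ => O (-Real.exp (-τ')) (ξ * Real.exp (-τ' / 2)))
      (Real.exp (-τ) * L (1, 0) + (-(ξ / 2) * Real.exp (-τ / 2)) * L (0, 1)) τ := by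
    rw [← hL]; exact hcomp
  exact (hasDerivAt_scale_of_tau τ).mul hcomp'

/-! ### The height derivatives of `Q` and of the transport term (fixed `τ`; `s, t` are constants) -/

/-- **`∂_ξQ = s²·∂_zO`** (at `ξ`, with `z = ξs`). -/
theorem hasDerivAt_simQ {s t ξ : ℝ} (hO : DifferentiableAt ℝ (O t) (ξ * s)) :
    HasDerivAt (fun ξ' : ℝ => s * O t (ξ' * s)) (s * (deriv (O t) (ξ * s) * s)) ξ := by
  have hin : HasDerivAt (fun ξ' : ℝ => ξ' * s) s ξ := by simpa using (hasDerivAt_id ξ).mul_const s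
  exact (hO.hasDerivAt.comp ξ hin).const_mul s

/-- **`∂_ξξQ = s³·∂_zzO`** (with `O(t,·)` differentiable near `z = ξs` and `∂_zO(t,·)` differentiable at `z`). -/
theorem deriv_deriv_simQ {s t ξ : ℝ} (hO1 : ∀ᶠ z in 𝓝 (ξ * s), DifferentiableAt ℝ (O t) z)
    (hO2 : DifferentiableAt ℝ (deriv (O t)) (ξ * s)) :
    deriv (deriv fun ξ' : ℝ => s * O t (ξ' * s)) ξ = s ^ 3 * deriv (deriv (O t)) (ξ * s) := by
  -- near `ξ`, `∂_ξQ(ξ') = s²·∂_zO(ξ's)`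
  have hcont : ContinuousAt (fun ξ' : ℝ => ξ' * s) ξ := by fun_prop
  have hnear : ∀ᶠ ξ' in 𝓝 ξ, DifferentiableAt ℝ (O t) (ξ' * s) := hcont.eventually hO1
  have h1 : deriv (fun ξ' : ℝ => s * O t (ξ' * s)) =ᶠ[𝓝 ξ] fun ξ' => s * s * deriv (O t) (ξ' * s) := by
    filter_upwards [hnear] with ξ' hξ'
    rw [(hasDerivAt_simQ hξ').deriv]; ring
  rw [h1.deriv_eq]
  have hin : HasDerivAt (fun ξ' : ℝ => ξ' * s) s ξ := by simpa using (hasDerivAt_id ξ).mul_const s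
  have h2 : HasDerivAt (fun ξ' : ℝ => s * s * deriv (O t) (ξ' * s)) (s * s * (deriv (deriv (O t)) (ξ * s) * s)) ξ :=
    (hO2.hasDerivAt.comp ξ hin).const_mul (s * s)
  rw [h2.deriv]; ring

/-- **The transport term**: `∂_ξ((ξ + Ŝ)Q) = s·O + ξs²·∂_zO + s³·∂_z(S·O)` at `ξ` (`z = ξs`). -/
theorem deriv_transport_sim {s t ξ : ℝ} (hO : DifferentiableAt ℝ (O t) (ξ * s)) (hS : DifferentiableAt ℝ (S t) (ξ * s)) :
    deriv (fun ξ' : ℝ => (ξ' + s * S t (ξ' * s)) * (s * O t (ξ' * s))) ξ =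
      s * O t (ξ * s) + ξ * s ^ 2 * deriv (O t) (ξ * s) + s ^ 3 * deriv (fun z => S t z * O t z) (ξ * s) := by
  have hin : HasDerivAt (fun ξ' : ℝ => ξ' * s) s ξ := by simpa using (hasDerivAt_id ξ).mul_const s
  have hQ := hasDerivAt_simQ (O := O) hO
  have hSh : HasDerivAt (fun ξ' : ℝ => ξ' + s * S t (ξ' * s)) (1 + s * (deriv (S t) (ξ * s) * s)) ξ :=
    (hasDerivAt_id ξ).add ((hS.hasDerivAt.comp ξ hin).const_mul s)
  rw [(hSh.fun_mul hQ).deriv, deriv_fun_mul hS hO]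
  ring

/-! ### The identity and the transfer of (OSC) -/

/-- **THE SIMILARITY IDENTITY** at one point.  With `s = e^{−τ/2}`, `t = −s²`, `z = ξs` and `Qt` the time derivative of `Q` from
`hasDerivAt_simQ_time` (there `L` is the joint derivative of `uncurry O` at `(t,z)`; here only `L(0,1) = ∂_zO` is used and `L(1,0)` plays `∂ₜO`):
`Qt + ½∂_ξ((ξ+Ŝ)Q) − ∂_ξξQ = s³·(∂ₜO + ½∂_z(S·O) − ∂_zzO)`. -/
theorem sim_identity {τ ξ : ℝ} {L : ℝ × ℝ →L[ℝ] ℝ}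
    (hO1 : ∀ᶠ z in 𝓝 (ξ * Real.exp (-τ / 2)), DifferentiableAt ℝ (O (-Real.exp (-τ))) z)
    (hO2 : DifferentiableAt ℝ (deriv (O (-Real.exp (-τ)))) (ξ * Real.exp (-τ / 2)))
    (hS : DifferentiableAt ℝ (S (-Real.exp (-τ))) (ξ * Real.exp (-τ / 2)))
    (hLz : L (0, 1) = deriv (O (-Real.exp (-τ))) (ξ * Real.exp (-τ / 2))) :
    (-(1 / 2) * Real.exp (-τ / 2) * O (-Real.exp (-τ)) (ξ * Real.exp (-τ / 2)) +
        Real.exp (-τ / 2) * (Real.exp (-τ) * L (1, 0) + (-(ξ / 2) * Real.exp (-τ / 2)) * L (0, 1)))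
      + (1 / 2) * deriv (fun ξ' : ℝ => (ξ' + Real.exp (-τ / 2) * S (-Real.exp (-τ)) (ξ' * Real.exp (-τ / 2))) *
          (Real.exp (-τ / 2) * O (-Real.exp (-τ)) (ξ' * Real.exp (-τ / 2)))) ξ
      - deriv (deriv fun ξ' : ℝ => Real.exp (-τ / 2) * O (-Real.exp (-τ)) (ξ' * Real.exp (-τ / 2))) ξ =
    Real.exp (-τ / 2) ^ 3 * (L (1, 0) + (1 / 2) * deriv (fun z => S (-Real.exp (-τ)) z * O (-Real.exp (-τ)) z)
      (ξ * Real.exp (-τ / 2)) - deriv (deriv (O (-Real.exp (-τ)))) (ξ * Real.exp (-τ / 2))) := by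
  set s := Real.exp (-τ / 2) with hs
  set t := -Real.exp (-τ) with ht
  have hss : Real.exp (-τ) = s * s := by rw [hs, ← Real.exp_add]; ring_nf
  rw [deriv_transport_sim (O := O) (S := S) hO1.self_of_nhds hS, deriv_deriv_simQ (O := O) hO1 hO2, hLz, hss]
  ring

/-- **(OSC) ⇒ the similarity inequality, pointwise.**  Under the hypotheses of `sim_identity`, if (OSC) holds at `(t,z)` in the form
`∂ₜO + ½∂_z(S·O) − ∂_zzO ≤ 0` (with `∂ₜO = L(1,0)`), then at `(τ,ξ)`:  `Qt + ½∂_ξ((ξ+Ŝ)Q) ≤ ∂_ξξQ` — the `hsub` hypothesis of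
`…TwistingTHOscLiouville.eq_zero_of_ancient_oscSubsolution_anyK` at that point, with `Qt` the derivative from `hasDerivAt_simQ_time`. -/
theorem sim_subsolution {τ ξ : ℝ} {L : ℝ × ℝ →L[ℝ] ℝ}
    (hO1 : ∀ᶠ z in 𝓝 (ξ * Real.exp (-τ / 2)), DifferentiableAt ℝ (O (-Real.exp (-τ))) z)
    (hO2 : DifferentiableAt ℝ (deriv (O (-Real.exp (-τ)))) (ξ * Real.exp (-τ / 2)))
    (hS : DifferentiableAt ℝ (S (-Real.exp (-τ))) (ξ * Real.exp (-τ / 2)))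
    (hLz : L (0, 1) = deriv (O (-Real.exp (-τ))) (ξ * Real.exp (-τ / 2)))
    (hosc : L (1, 0) + (1 / 2) * deriv (fun z => S (-Real.exp (-τ)) z * O (-Real.exp (-τ)) z) (ξ * Real.exp (-τ / 2))
      - deriv (deriv (O (-Real.exp (-τ)))) (ξ * Real.exp (-τ / 2)) ≤ 0) :
    (-(1 / 2) * Real.exp (-τ / 2) * O (-Real.exp (-τ)) (ξ * Real.exp (-τ / 2)) +
        Real.exp (-τ / 2) * (Real.exp (-τ) * L (1, 0) + (-(ξ / 2) * Real.exp (-τ / 2)) * L (0, 1)))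
      + (1 / 2) * deriv (fun ξ' : ℝ => (ξ' + Real.exp (-τ / 2) * S (-Real.exp (-τ)) (ξ' * Real.exp (-τ / 2))) *
          (Real.exp (-τ / 2) * O (-Real.exp (-τ)) (ξ' * Real.exp (-τ / 2)))) ξ ≤
      deriv (deriv fun ξ' : ℝ => Real.exp (-τ / 2) * O (-Real.exp (-τ)) (ξ' * Real.exp (-τ / 2))) ξ := by
  have h := sim_identity (O := O) (S := S) hO1 hO2 hS hLz
  have hs3 : 0 < Real.exp (-τ / 2) ^ 3 := by positivity
  have hneg : Real.exp (-τ / 2) ^ 3 * (L (1, 0) + (1 / 2) * deriv (fun z => S (-Real.exp (-τ)) z * O (-Real.exp (-τ)) z)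
      (ξ * Real.exp (-τ / 2)) - deriv (deriv (O (-Real.exp (-τ)))) (ξ * Real.exp (-τ / 2))) ≤ 0 :=
    mul_nonpos_of_nonneg_of_nonpos hs3.le hosc
  linarith

end Summit.NavierStokesRegularity.NavierStokesRegularity.Theorems.PoloidalWindowDoorLrcModEntireTwistingTHPlaneOscillationSimilarityMap
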